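import Literature.AlgebraicGeometry.Resolution.AlterationsSemiStableCodimTwoThicknessDrop
import HarnessLib

/-!
# `WildQuotients.SummitReduction` (stmt-ResolutionOfSingularities-16324), line `FramePerfect`, skeleton v8:
# helper lemmas for stub `stub_pair_orbitBlowupCentreNew` (C3) — transfer of a base-compatible
# formal model along the chart of a blow-up (de Jong 1996, 3.4, p. 64; Stacks 0804)

Route `ResolutionOfSingularities/WildQuotients`, crux `SummitReduction`; worker file supporting the
registered stub `stub_pair_orbitBlowupCentreNew` of the line skeleton (v8, lead c4).

The any-field form of the tree's `DeJong1996.SemiStablePair.exists_chartMap_codimTwo`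
(`AlterationsSemiStableCodimTwoThicknessDrop.lean`): that theorem is stated for the curve of a pair in
Situation 4.23 over an algebraically closed field at a CLOSED point `x'₁` of the blow-up, where every
element of `𝒪̂_{X',x'₁}` is a constant of `k` modulo `𝔪`; its proof uses this only through
"every germ at `x'₁` is a germ of `𝒪_{Y,y}` plus an element of `𝔪_{x'₁}`", which over an arbitrary
field holds at the new codimension-2 singular point by `centreNew_transfer_residue`
(`…CentreNewResidue.lean`). `centreNew_exists_chartMap` is the same statement and proof with that
hypothesis (`hres₁`) in place of algebraic closedness, for any blow-up `π : X' ⟶ X` of an ideal sheaf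
whose stalk at `π x'₁` is prescribed: the induced local map `φ : Â⟦u, v⟧/(uv - h) → C = 𝒪̂_{X',x'₁}`,
the centre becoming the invertible ideal `(φ g) C` (Stacks 0804 read in `C`), and the generation of
`𝔪_C` by `φ(u), φ(v), 𝔪_Â C` and the recentred quotients — the input of the chart computation
`NodeDeformationRing.charts_of_base` (`NodalBlowupFormalChartsCodimTwo.lean`).
-/

set_option linter.dupNamespace false

noncomputable section

open CategoryTheory CategoryTheory.Limits AlgebraicGeometry TopologicalSpace Topology
open Literature.AlgebraicGeometry.Resolution
open Literature.AlgebraicGeometry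
open IsLocalRing Scheme.IdealSheafData DeJong1996 DeJong1996.FormalNodeRing NodalDeformation

namespace Summit.ResolutionOfSingularities.ResolutionOfSingularities.Theorems

universe u

set_option maxHeartbeats 1600000 in
/-- **Transfer along the chart of the blow-up, over any field** (the tree's
`DeJong1996.SemiStablePair.exists_chartMap_codimTwo` with algebraic closedness replaced by the residue
hypothesis `hres₁`). For a blow-up `π : X' ⟶ X` (`X` Noetherian, `X'` integral) of an ideal sheaf `PT`
with stalk `Pst` at `π x'₁`, a morphism `f : X ⟶ Y` to a locally Noetherian `Y`, and an isomorphism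
`E : 𝒪̂_{X,π x'₁} ≅ Â⟦u, v⟧/(uv - h)` over `Â = 𝒪̂_{Y,f(π x'₁)}` (`h ∈ 𝔪_Â`) carrying `Pst 𝒪̂` onto
`(u, v, t_c)`, where every germ at `x'₁` is a germ of `𝒪_{Y,f(π x'₁)}` modulo `𝔪_{x'₁}`: the induced
local map `φ : Â⟦u, v⟧/(uv - h) → C = 𝒪̂_{X',x'₁}` is compatible with `𝒪_Y → 𝒪_{X'}`, every element
of `C` is an `Â`-constant modulo `𝔪_C`, the centre becomes an invertible ideal `(φ g)C` (Stacks 0804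
read in `C`, `𝒪_{X',x'₁} → C` flat), and `𝔪_C` is generated by `φ(u), φ(v), 𝔪_Â C` and the recentred
quotients `φ(z)/φ(g)`, `z ∈ (u, v, t_c)`. [cite: DeJong1996, 3.4, p. 64] [cite: StacksProject, Tag 0804] -/
theorem centreNew_exists_chartMap {X X' Y : Scheme.{u}} [IsIntegral X'] [IsNoetherian X]
    [IsLocallyNoetherian X'] [IsLocallyNoetherian Y] (f : X ⟶ Y) {π : X' ⟶ X}
    (PT : X.IdealSheafData) (hπ : IsBlowup π PT) {x'₁ : X'}
    {Pst : Ideal (X.presheaf.stalk (π x'₁))} (hPTstalk : stalkIdeal PT (π x'₁) = Pst)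
    {h tc : Cpl (Y.presheaf.stalk (f (π x'₁)))}
    (hh : h ∈ maximalIdeal (Cpl (Y.presheaf.stalk (f (π x'₁)))))
    (E : Cpl (X.presheaf.stalk (π x'₁)) ≃+* NodeDeformationRing (Cpl (Y.presheaf.stalk (f (π x'₁)))) h)
    (hE₁ : ∀ a : Y.presheaf.stalk (f (π x'₁)),
      E (algebraMap (X.presheaf.stalk (π x'₁)) (Cpl (X.presheaf.stalk (π x'₁)))
        ((f.stalkMap (π x'₁)).hom a)) =
        NodeDeformationRing.ofBase _ h
          (AdicCompletion.of (maximalIdeal (Y.presheaf.stalk (f (π x'₁)))) _ a))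
    (hE₂ : (Pst.map
        (algebraMap (X.presheaf.stalk (π x'₁)) (Cpl (X.presheaf.stalk (π x'₁))))).map E.toRingHom =
      Ideal.span {Ideal.Quotient.mk _ (MvPowerSeries.X 0), Ideal.Quotient.mk _ (MvPowerSeries.X 1),
        NodeDeformationRing.ofBase _ h tc})
    (hres₁ : ∀ r : X'.presheaf.stalk x'₁, ∃ a : Y.presheaf.stalk (f (π x'₁)),
      r - ((π ≫ f).stalkMap x'₁).hom a ∈ maximalIdeal (X'.presheaf.stalk x'₁)) :
    ∃ (φ : NodeDeformationRing (Cpl (Y.presheaf.stalk (f (π x'₁)))) h →+* Cpl (X'.presheaf.stalk x'₁))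
      (gM : NodeDeformationRing (Cpl (Y.presheaf.stalk (f (π x'₁)))) h),
      IsLocalHom φ ∧ IsLocalHom (φ.comp (NodeDeformationRing.ofBase _ h)) ∧
      (∀ a : Y.presheaf.stalk (f (π x'₁)),
        φ (NodeDeformationRing.ofBase _ h
          (AdicCompletion.of (maximalIdeal (Y.presheaf.stalk (f (π x'₁)))) _ a)) =
          algebraMap (X'.presheaf.stalk x'₁) (Cpl (X'.presheaf.stalk x'₁))
            (((π ≫ f).stalkMap x'₁).hom a)) ∧
      (∀ c : Cpl (X'.presheaf.stalk x'₁), ∃ l,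
        c - φ (NodeDeformationRing.ofBase _ h l) ∈ maximalIdeal (Cpl (X'.presheaf.stalk x'₁))) ∧
      gM ∈ Ideal.span ({Ideal.Quotient.mk _ (MvPowerSeries.X 0), Ideal.Quotient.mk _ (MvPowerSeries.X 1),
        NodeDeformationRing.ofBase _ h tc} : Set (NodeDeformationRing _ h)) ∧
      φ gM ∈ nonZeroDivisors (Cpl (X'.presheaf.stalk x'₁)) ∧
      (Ideal.span ({Ideal.Quotient.mk _ (MvPowerSeries.X 0), Ideal.Quotient.mk _ (MvPowerSeries.X 1),
        NodeDeformationRing.ofBase _ h tc} : Set (NodeDeformationRing _ h))).map φ =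
        Ideal.span {φ gM} ∧
      (∀ N : Ideal (Cpl (X'.presheaf.stalk x'₁)),
        φ (Ideal.Quotient.mk _ (MvPowerSeries.X 0)) ∈ N →
        φ (Ideal.Quotient.mk _ (MvPowerSeries.X 1)) ∈ N →
        (maximalIdeal _).map (φ.comp (NodeDeformationRing.ofBase _ h)) ≤ N →
        (∀ z ∈ Ideal.span ({Ideal.Quotient.mk _ (MvPowerSeries.X 0),
            Ideal.Quotient.mk _ (MvPowerSeries.X 1), NodeDeformationRing.ofBase _ h tc} :
              Set (NodeDeformationRing _ h)),
          ∀ (w : Cpl (X'.presheaf.stalk x'₁)) (l : Cpl (Y.presheaf.stalk (f (π x'₁)))),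
            φ gM * w = φ z →
            w - φ (NodeDeformationRing.ofBase _ h l) ∈ maximalIdeal (Cpl (X'.presheaf.stalk x'₁)) →
              w - φ (NodeDeformationRing.ofBase _ h l) ∈ N) →
        maximalIdeal (Cpl (X'.presheaf.stalk x'₁)) ≤ N) := by
  classical
  -- rings
  let A : Type u := Y.presheaf.stalk (f (π x'₁))
  let Λ : Type u := Cpl A
  let O : Type u := X.presheaf.stalk (π x'₁)
  let R : Type u := X'.presheaf.stalk x'₁
  let C : Type u := Cpl R
  let M₀ : Type u := NodeDeformationRing Λ h
  haveI : IsNoetherianRing C := isNoetherianRing_adicCompletion_maximalIdeal R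
  haveI : Module.FaithfullyFlat R C := Module.FaithfullyFlat.of_flat_of_isLocalHom (A := R) (B := C)
  -- the completed stalk of the centre in `M₀`
  have hΛcentre' : ((stalkIdeal PT (π x'₁)).map (algebraMap O (Cpl O))).map E.toRingHom =
      Ideal.span ({Ideal.Quotient.mk _ (MvPowerSeries.X 0), Ideal.Quotient.mk _ (MvPowerSeries.X 1),
        NodeDeformationRing.ofBase Λ h tc} : Set M₀) := by
    rw [hPTstalk]
    exact hE₂
  -- ### the chart of the blow-up at `x'₁` (Stacks 0804)
  obtain ⟨U, V, hVU, b, hb, ech, hxV, hech⟩ := hπ.exists_chart x'₁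
  have hxU : (π x'₁) ∈ (U : X.Opens) := hVU hxV
  haveI : Nonempty (V : X'.Opens) := ⟨⟨x'₁, hxV⟩⟩
  -- maps
  let σ : O →+* R := (π.stalkMap x'₁).hom
  have hσloc : IsLocalHom σ := inferInstance
  have hσle : (maximalIdeal O).map σ ≤ maximalIdeal R := ((IsLocalRing.local_hom_TFAE σ).out 0 2).mp hσloc
  let ψπ : Cpl O →+* C := adicCompletionMap (maximalIdeal O) (maximalIdeal R) σ hσle
  let φ : M₀ →+* C := ψπ.comp E.symm.toRingHom
  let germU : Γ(X, U) →+* O := (X.presheaf.germ U (π x'₁) hxU).hom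
  let germV : Γ(X', V) →+* R := (X'.presheaf.germ V x'₁ hxV).hom
  let appUV : Γ(X, U) →+* Γ(X', V) := (π.appLE U V hVU).hom
  let toM : Γ(X, U) →+* M₀ := E.toRingHom.comp ((algebraMap O (Cpl O)).comp germU)
  have hσgerm : ∀ c, σ (germU c) = germV (appUV c) := fun c => stalkMap_germ_appLE π hVU hxV c
  have hψof : ∀ o : O, ψπ (algebraMap O (Cpl O) o) = algebraMap R C (σ o) := fun o =>
    adicCompletionMap_of (maximalIdeal O) (maximalIdeal R) σ hσle o
  have hφe : ∀ z : Cpl O, φ (E z) = ψπ z := fun z => by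
    change ψπ (E.symm (E z)) = ψπ z
    rw [RingEquiv.symm_apply_apply]
  have hφtoM : ∀ c, φ (toM c) = algebraMap R C (germV (appUV c)) := by
    intro c
    change φ (E (algebraMap O (Cpl O) (germU c))) = _
    rw [hφe, hψof, hσgerm]
  have hφtoM' : φ.comp toM = (algebraMap R C).comp (germV.comp appUV) := RingHom.ext fun c => hφtoM c
  have hechsymm : ∀ c, ech.symm (algebraMap Γ(X, U) (blowupAlgebra _ b) c) = appUV c := by
    intro c
    rw [← RingHom.congr_fun hech c]
    exact ech.symm_apply_apply _
  -- `φ ∘ (Λ → M₀)` on `Â`-elements coming from `A`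
  have hφof : ∀ a : A, φ (NodeDeformationRing.ofBase Λ _ (AdicCompletion.of (maximalIdeal A) A a)) =
      algebraMap R C (((π ≫ f).stalkMap x'₁).hom a) := by
    intro a
    rw [← hE₁, hφe, hψof, Scheme.Hom.stalkMap_comp]
    rfl
  -- ### `𝔭C = (φ g)` for `g = toM b`, regular
  let gM : M₀ := toM b
  have hcompleted : ∀ I : X.IdealSheafData,
      completedStalkIdeal I (π x'₁) U hxU = (stalkIdeal I (π x'₁)).map (algebraMap O (Cpl O)) :=
    fun I => completedStalkIdeal_eq_map_stalkIdeal I (π x'₁) U hxU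
  have h𝔭M : (PT.ideal U).map toM = Ideal.span ({Ideal.Quotient.mk _ (MvPowerSeries.X 0),
      Ideal.Quotient.mk _ (MvPowerSeries.X 1), NodeDeformationRing.ofBase Λ h tc} : Set M₀) := by
    rw [← hΛcentre', ← hcompleted PT]
    unfold completedStalkIdeal
    rw [Ideal.map_map, Ideal.map_map]
    rfl
  have hgM : gM ∈ Ideal.span ({Ideal.Quotient.mk _ (MvPowerSeries.X 0),
      Ideal.Quotient.mk _ (MvPowerSeries.X 1), NodeDeformationRing.ofBase Λ h tc} : Set M₀) :=
    h𝔭M ▸ Ideal.mem_map_of_mem toM hb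
  let bV : Γ(X', V) := appUV b
  let bR : R := germV bV
  have hφg : φ gM = algebraMap R C bR := hφtoM b
  have hbV : bV ≠ 0 := by
    intro h0
    have h1 : ech bV = algebraMap Γ(X, U) (blowupAlgebra (PT.ideal U) b) b := RingHom.congr_fun hech b
    rw [h0, map_zero] at h1
    haveI : Nontrivial (blowupAlgebra (PT.ideal U) b) := ech.symm.toRingHom.domain_nontrivial
    exact (nonZeroDivisors.ne_zero algebraMap_mem_nonZeroDivisors_blowupAlgebra) h1.symm
  have hbR : bR ∈ nonZeroDivisors R := by
    refine mem_nonZeroDivisors_of_ne_zero ?_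
    exact (map_ne_zero_iff _ (germ_injective_of_isIntegral X' x'₁ hxV)).mpr hbV
  have hgC : φ gM ∈ nonZeroDivisors C := by
    rw [hφg]
    exact map_mem_nonZeroDivisors_of_flat (algebraMap R C)
      (RingHom.flat_algebraMap_iff.mpr inferInstance) hbR
  have hPapp : (PT.ideal U).map appUV = Ideal.span {bV} := by
    have h1 : appUV = ech.symm.toRingHom.comp (algebraMap Γ(X, U) (blowupAlgebra (PT.ideal U) b)) :=
      RingHom.ext fun c => (hechsymm c).symm
    rw [h1, ← Ideal.map_map, map_blowupAlgebra_eq_span hb, Ideal.map_span, Set.image_singleton]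
    change Ideal.span {ech.symm (algebraMap _ _ b)} = _
    rw [hechsymm]
  have h𝔭C : (Ideal.span ({Ideal.Quotient.mk _ (MvPowerSeries.X 0),
      Ideal.Quotient.mk _ (MvPowerSeries.X 1), NodeDeformationRing.ofBase Λ h tc} : Set M₀)).map φ =
      Ideal.span {φ gM} := by
    rw [← h𝔭M, Ideal.map_map, hφtoM', ← Ideal.map_map, ← Ideal.map_map, hPapp, Ideal.map_span,
      Set.image_singleton, Ideal.map_span, Set.image_singleton, hφg]
  -- ### `φ` and `ψ = φ ∘ (Λ → M₀)` are local
  haveI hM₀loc : IsLocalRing M₀ := NodeDeformationRing.isLocalRing hh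
  have hφmax : ∀ y : M₀, ¬ IsUnit y → φ y ∈ maximalIdeal C := by
    intro y hy
    have h1 : E.symm y ∈ maximalIdeal (Cpl O) := by
      rw [mem_maximalIdeal, mem_nonunits_iff]
      intro hu
      exact hy (by simpa using hu.map E)
    rw [AdicCompletion.maximalIdeal_eq_map] at h1
    have h2 : φ y ∈ ((maximalIdeal O).map (algebraMap O (Cpl O))).map ψπ := by
      change ψπ (E.symm y) ∈ _
      exact Ideal.mem_map_of_mem ψπ h1
    rw [Ideal.map_map, show ψπ.comp (algebraMap O (Cpl O)) = (algebraMap R C).comp σ from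
      RingHom.ext fun o => hψof o, ← Ideal.map_map] at h2
    rw [AdicCompletion.maximalIdeal_eq_map]
    exact Ideal.map_mono hσle h2
  haveI hφloc : IsLocalHom φ := ⟨fun y hy => by
    by_contra hyu
    exact ((mem_maximalIdeal _).mp (hφmax y hyu)) hy⟩
  haveI hψloc : IsLocalHom (φ.comp (NodeDeformationRing.ofBase Λ h)) :=
    @RingHom.isLocalHom_comp _ _ _ _ _ _ _ _ hφloc (NodeDeformationRing.isLocalHom_ofBase hh)
  -- ### the residue field of `C` through `Λ`
  have H1 : ∀ c : C, ∃ l : Λ, c - φ (NodeDeformationRing.ofBase Λ h l) ∈ maximalIdeal C := by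
    intro c
    obtain ⟨r, hr⟩ := NodalDeformation.exists_sub_algebraMap_mem_pow (A := R) c 1
    rw [pow_one] at hr
    obtain ⟨a, ha⟩ := hres₁ r
    refine ⟨AdicCompletion.of (maximalIdeal A) A a, ?_⟩
    rw [hφof]
    have ha' : algebraMap R C r - algebraMap R C (((π ≫ f).stalkMap x'₁).hom a) ∈ maximalIdeal C := by
      rw [← map_sub, AdicCompletion.maximalIdeal_eq_map]
      exact Ideal.mem_map_of_mem _ ha
    have := Ideal.add_mem _ hr ha'
    rwa [sub_add_sub_cancel] at this
  -- ### `𝔪_C` is generated by `φ(u), φ(v), ψ(𝔪_Λ)` and the recentred quotients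
  have H3 : ∀ N : Ideal C,
      φ (Ideal.Quotient.mk _ (MvPowerSeries.X 0)) ∈ N →
      φ (Ideal.Quotient.mk _ (MvPowerSeries.X 1)) ∈ N →
      (maximalIdeal Λ).map (φ.comp (NodeDeformationRing.ofBase Λ h)) ≤ N →
      (∀ z ∈ Ideal.span ({Ideal.Quotient.mk _ (MvPowerSeries.X 0),
          Ideal.Quotient.mk _ (MvPowerSeries.X 1), NodeDeformationRing.ofBase Λ h tc} : Set M₀),
        ∀ (w : C) (l : Λ), φ gM * w = φ z →
          w - φ (NodeDeformationRing.ofBase Λ _ l) ∈ maximalIdeal C →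
            w - φ (NodeDeformationRing.ofBase Λ _ l) ∈ N) →
      maximalIdeal C ≤ N := by
    intro N hu hv hΛN hcl
    by_cases hN : N = ⊤
    · rw [hN]; exact le_top
    have hNle : N ≤ maximalIdeal C := IsLocalRing.le_maximalIdeal hN
    -- every element of the chart ring is a `Λ`-constant modulo `N`
    let θ : blowupAlgebra (PT.ideal U) b →+* C := (algebraMap R C).comp (germV.comp ech.symm.toRingHom)
    have hθalg : ∀ c : Γ(X, U), θ (algebraMap Γ(X, U) (blowupAlgebra (PT.ideal U) b) c) = φ (toM c) := by
      intro c
      change algebraMap R C (germV (ech.symm (algebraMap Γ(X, U) (blowupAlgebra (PT.ideal U) b) c))) = _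
      rw [hechsymm, hφtoM]
    have hall : ∀ (y : Localization.Away b) (hy : y ∈ blowupAlgebra (PT.ideal U) b),
        ∃ l : Λ, θ ⟨y, hy⟩ - φ (NodeDeformationRing.ofBase Λ _ l) ∈ N := by
      intro y hy
      unfold blowupAlgebra at hy
      induction hy using Algebra.adjoin_induction with
      | mem y hy =>
        obtain ⟨z, hz, rfl⟩ := hy
        obtain ⟨w, hw⟩ : ∃ w : C, w = θ ⟨_, Algebra.subset_adjoin (⟨z, hz, rfl⟩ :
            algebraMap Γ(X, U) (Localization.Away b) z * IsLocalization.Away.invSelf b ∈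
              blowupAlgebraGens (PT.ideal U) b)⟩ := ⟨_, rfl⟩
        have hwz : φ gM * w = φ (toM z) := by
          rw [← hθalg, ← hθalg, mul_comm, hw, ← map_mul]
          congr 1
          exact Subtype.ext (div_mul_algebraMap b z)
        obtain ⟨l, hl⟩ := H1 w
        refine ⟨l, ?_⟩
        rw [← hw]
        exact hcl (toM z) (h𝔭M ▸ Ideal.mem_map_of_mem toM hz) w l hwz hl
      | algebraMap c =>
        obtain ⟨l, hl⟩ := NodeDeformationRing.exists_sub_ofBase_mem φ N hu hv (toM c)
        refine ⟨l, ?_⟩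
        rw [← hθalg] at hl
        exact hl
      | add y z hy hz ihy ihz =>
        obtain ⟨l₁, h₁⟩ := ihy
        obtain ⟨l₂, h₂⟩ := ihz
        refine ⟨l₁ + l₂, ?_⟩
        have : θ ⟨y + z, Subalgebra.add_mem _ hy hz⟩ = θ ⟨y, hy⟩ + θ ⟨z, hz⟩ := by
          rw [← map_add]; rfl
        rw [this, map_add, map_add]
        convert N.add_mem h₁ h₂ using 1
        ring
      | mul y z hy hz ihy ihz =>
        obtain ⟨l₁, h₁⟩ := ihy
        obtain ⟨l₂, h₂⟩ := ihz
        refine ⟨l₁ * l₂, ?_⟩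
        have : θ ⟨y * z, Subalgebra.mul_mem _ hy hz⟩ = θ ⟨y, hy⟩ * θ ⟨z, hz⟩ := by
          rw [← map_mul]; rfl
        rw [this, map_mul, map_mul]
        convert N.add_mem (N.mul_mem_left (θ ⟨y, hy⟩) h₂)
          (N.mul_mem_right (φ (NodeDeformationRing.ofBase Λ _ l₂)) h₁) using 1
        ring
    -- now `𝔪_C = 𝔪_R C` and `𝔪_R = 𝔫 R` for the prime `𝔫` of `x'₁` in `Γ(X', V)`
    rw [AdicCompletion.maximalIdeal_eq_map, Ideal.map_le_iff_le_comap]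
    intro r hr
    letI := TopCat.Presheaf.algebra_section_stalk X'.presheaf (⟨x'₁, hxV⟩ : (V : X'.Opens))
    haveI := V.2.isLocalization_stalk ⟨x'₁, hxV⟩
    obtain ⟨a, tt, rfl⟩ := IsLocalization.exists_mk'_eq (V.2.primeIdealOf ⟨x'₁, hxV⟩).asIdeal.primeCompl r
    have ha : a ∈ (V.2.primeIdealOf ⟨x'₁, hxV⟩).asIdeal :=
      (IsLocalization.AtPrime.mk'_mem_maximal_iff R (V.2.primeIdealOf ⟨x'₁, hxV⟩).asIdeal a tt).mp hr
    obtain ⟨l, hl⟩ := hall (ech a).1 (ech a).2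
    have hθa : θ ⟨(ech a).1, (ech a).2⟩ = algebraMap R C (germV a) := by
      change algebraMap R C (germV (ech.symm (ech a))) = _
      rw [RingEquiv.symm_apply_apply]
    rw [hθa] at hl
    have hgermA : algebraMap R C (germV a) ∈ maximalIdeal C := by
      rw [AdicCompletion.maximalIdeal_eq_map]
      exact Ideal.mem_map_of_mem _
        ((IsLocalization.AtPrime.to_map_mem_maximal_iff R (V.2.primeIdealOf ⟨x'₁, hxV⟩).asIdeal a).mpr ha)
    have hl0 : φ (NodeDeformationRing.ofBase Λ _ l) ∈ N := by
      have h2 : φ (NodeDeformationRing.ofBase Λ _ l) ∈ maximalIdeal C := by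
        have := Ideal.sub_mem _ hgermA (hNle hl)
        rwa [sub_sub_cancel] at this
      have h3 : l ∈ maximalIdeal Λ := by
        rw [mem_maximalIdeal, mem_nonunits_iff]
        intro hlu
        exact ((mem_maximalIdeal _).mp h2) ((hlu.map _).map φ)
      exact hΛN (Ideal.mem_map_of_mem _ h3)
    have hgermN : algebraMap R C (germV a) ∈ N := by
      have := N.add_mem hl hl0
      rwa [sub_add_cancel] at this
    obtain ⟨tu, htu⟩ := IsLocalization.map_units R tt
    have hmk : IsLocalization.mk' R a tt = algebraMap Γ(X', V) R a * ↑tu⁻¹ := by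
      rw [Units.eq_mul_inv_iff_mul_eq, htu]
      exact IsLocalization.mk'_spec R a tt
    rw [Ideal.mem_comap, hmk, map_mul]
    exact N.mul_mem_right _ hgermN
  exact ⟨φ, gM, hφloc, hψloc, hφof, H1, hgM, hgC, h𝔭C, H3⟩

end Summit.ResolutionOfSingularities.ResolutionOfSingularities.Theorems

end
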